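import Mathlib
import Literature.Analysis.FluidPDE.Tao2016AveragedNS.ShiftSetCascadeFlows
import HarnessLib

/-!
# Route TaoLadderRungTwoFlat: the MIRROR-SEEDED TODA TABLE `mirrorTable ε δ` (route-posited object; definitions
  module for the crux K_A♭ = `FlatGapCertificatesV2`, stmt-NavierStokesRegularity-22987, and its registered
  stubs `stub_mirrorGapData` / `stub_rung` / `stub_rung_quarter`; cell harvest/h2-tao-ladder)

The m = 2 table on the two-way nearest-neighbour shift set `S♭` posited by route `TaoLadderRungTwoFlat`
(theory-1 g14, BC3 birth skeleton `birth_KA_quarter.lean` sha16 630a5700be442b76, registered on 22987): the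
Toda block in Flaschka-type variables (carrier `a` = species `0`, bond `v` = species `1`), an emitter seed
`ε` within the shell and a MIRROR seed `δ` on the backscatter classes. Landed here VERBATIM from the skeleton
(same `def`, same three class lemmas), so that provers can state and close the registered stubs — whose
signatures read `mirrorTable (1 / 2) (1 / 2)` — against a tree declaration. The lattice it drives (δ = ε,
scale ratio `λ = (1+ε₀)` in Tao's `(5/2)`-clock units): `ȧ_n = −λⁿv_n² + λ^{n−1}v_{n−1}² − ελⁿa_nv_n +
ελ^{n−1}a_nv_{n−1}`, `v̇_n = λⁿ[v_n(a_n − a_{n+1}) + ε(a_n² − a_{n+1}²)]`.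

Contents: `mirrorTable`; `isSymmetricCoeffOn_mirrorTable` (4.2 on `S♭`); `isCancellingCoeffOn_mirrorTable`
(4.3 on `S♭`, backscatter classes included); `mirrorTable_values`, `mirrorTable_eq_zero_of_not_mem` (support);
`isComparableCoeffOn_mirrorTable` and `inTableClassOn_mirrorTable` — for `0 < ε ≤ 1` the table at `δ = ε`
lies in the class `E(S♭, 2/ε)` (= the skeleton's `stub_mirrorTable_mem`, proved there in-skeleton).

HONEST FRAMING: a definition and finite algebra about a MODEL lattice table (Tao 2016 §4 vocabulary,
shift-set parametrised); nothing is asserted about its dynamics, and nothing here is a statement about the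
Navier–Stokes equations.
-/

noncomputable section

-- the sub-problem namespace repeats the summit name by design (D-0017)
set_option linter.dupNamespace false

namespace Summit.NavierStokesRegularity.NavierStokesRegularity.Theorems

open Literature.Analysis.FluidPDE Literature.Analysis.FluidPDE.TaoCascade

/-- **The m = 2 MIRROR-SEEDED TODA TABLE on `S♭`** (`Fin 2` species: `0` = carrier `a`, `1` = bond `v`; a
term `α i₁ i₂ i₃ μ` drives `X_{i₃,n'+μ₃}` by `λ^{n'} X_{i₁,n'+μ₁} X_{i₂,n'+μ₂}`). Entries: Toda block
`(v,v,a)@0 = −1`, `(v,a,v)@0 = (a,v,v)@0 = ½`, `(v,v,a)@(0,0,1) = 1`, `(v,a,v)@(0,1,0) = (a,v,v)@(1,0,0) = −½`;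
emitter seed `(a,a,v)@0 = ε`, `(a,v,a)@0 = (v,a,a)@0 = −ε/2`; MIRROR seed on the backscatter classes
`(a,a,v)@(1,1,0) = −δ`, `(a,v,a)@(1,0,1) = (v,a,a)@(0,1,1) = δ/2`; all else `0`.
[cite: Tao2016AveragedNS, §4 (4.1)–(4.3) (structure constants on a shift set); route TaoLadderRungTwoFlat, posited object] -/
def mirrorTable (ε δ : ℝ) : Fin 2 → Fin 2 → Fin 2 → ℤ × ℤ × ℤ → ℝ := fun i₁ i₂ i₃ μ =>
  if μ = (0, 0, 0) then
    (if i₁ = 1 ∧ i₂ = 1 ∧ i₃ = 0 then -1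
      else if i₁ = 1 ∧ i₂ = 0 ∧ i₃ = 1 then 1 / 2
      else if i₁ = 0 ∧ i₂ = 1 ∧ i₃ = 1 then 1 / 2
      else if i₁ = 0 ∧ i₂ = 0 ∧ i₃ = 1 then ε
      else if i₁ = 0 ∧ i₂ = 1 ∧ i₃ = 0 then -ε / 2
      else if i₁ = 1 ∧ i₂ = 0 ∧ i₃ = 0 then -ε / 2
      else 0)
  else if μ = (0, 0, 1) then (if i₁ = 1 ∧ i₂ = 1 ∧ i₃ = 0 then 1 else 0)
  else if μ = (0, 1, 0) then (if i₁ = 1 ∧ i₂ = 0 ∧ i₃ = 1 then -1 / 2 else 0)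
  else if μ = (1, 0, 0) then (if i₁ = 0 ∧ i₂ = 1 ∧ i₃ = 1 then -1 / 2 else 0)
  else if μ = (1, 1, 0) then (if i₁ = 0 ∧ i₂ = 0 ∧ i₃ = 1 then -δ else 0)
  else if μ = (1, 0, 1) then (if i₁ = 0 ∧ i₂ = 1 ∧ i₃ = 0 then δ / 2 else 0)
  else if μ = (0, 1, 1) then (if i₁ = 1 ∧ i₂ = 0 ∧ i₃ = 0 then δ / 2 else 0)
  else 0

/-- Symmetry (4.2) on `S♭` of the mirror-seeded Toda table. [cite: Tao2016AveragedNS, §4 (4.2)] -/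
theorem isSymmetricCoeffOn_mirrorTable (ε δ : ℝ) :
    IsSymmetricCoeffOn shiftSetFlat (mirrorTable ε δ) := by
  intro i₁ i₂ i₃ μ₁ μ₂ μ₃ hμ
  rcases (mem_shiftSetFlat_iff _).1 hμ with h | h | h | h | h | h | h <;>
    simp only [Prod.mk.injEq] at h <;> obtain ⟨rfl, rfl, rfl⟩ := h <;>
    fin_cases i₁ <;> fin_cases i₂ <;> fin_cases i₃ <;>
    simp [mirrorTable]

/-- Cancellation (4.3) on `S♭` (the six-permutation sum) of the mirror-seeded Toda table.
[cite: Tao2016AveragedNS, §4 (4.3)] -/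
theorem isCancellingCoeffOn_mirrorTable (ε δ : ℝ) :
    IsCancellingCoeffOn shiftSetFlat (mirrorTable ε δ) := by
  intro i₁ i₂ i₃ μ₁ μ₂ μ₃ hμ
  rcases (mem_shiftSetFlat_iff _).1 hμ with h | h | h | h | h | h | h <;>
    simp only [Prod.mk.injEq] at h <;> obtain ⟨rfl, rfl, rfl⟩ := h <;>
    fin_cases i₁ <;> fin_cases i₂ <;> fin_cases i₃ <;>
    simp [mirrorTable] <;> ring

/-- Every entry of the mirror-seeded Toda table is one of `0, −1, 1/2, ε, −ε/2, 1, −1/2, −δ, δ/2`.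
[cite: Tao2016AveragedNS, §4 (4.1) (structure constants); route TaoLadderRungTwoFlat, posited object] -/
theorem mirrorTable_values (ε δ : ℝ) (i₁ i₂ i₃ : Fin 2) (μ : ℤ × ℤ × ℤ) :
    mirrorTable ε δ i₁ i₂ i₃ μ = 0 ∨ mirrorTable ε δ i₁ i₂ i₃ μ = -1 ∨ mirrorTable ε δ i₁ i₂ i₃ μ = 1 / 2 ∨
      mirrorTable ε δ i₁ i₂ i₃ μ = ε ∨ mirrorTable ε δ i₁ i₂ i₃ μ = -ε / 2 ∨ mirrorTable ε δ i₁ i₂ i₃ μ = 1 ∨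
      mirrorTable ε δ i₁ i₂ i₃ μ = -1 / 2 ∨ mirrorTable ε δ i₁ i₂ i₃ μ = -δ ∨
      mirrorTable ε δ i₁ i₂ i₃ μ = δ / 2 := by
  simp only [mirrorTable]
  split_ifs <;> simp

/-- The mirror-seeded Toda table is supported on `S♭`.
[cite: Tao2016AveragedNS, §4 after (4.1) (the shift set); route TaoLadderRungTwoFlat, posited object] -/
theorem mirrorTable_eq_zero_of_not_mem (ε δ : ℝ) (i₁ i₂ i₃ : Fin 2) (μ : ℤ × ℤ × ℤ)
    (hμ : μ ∉ shiftSetFlat) : mirrorTable ε δ i₁ i₂ i₃ μ = 0 := by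
  rw [mem_shiftSetFlat_iff] at hμ
  push Not at hμ
  obtain ⟨h1, h2, h3, h4, h5, h6, h7⟩ := hμ
  simp [mirrorTable, h1, h2, h3, h4, h5, h6, h7]

/-- Comparability on `S♭` with spread `2/ε` at `δ = ε`, `0 < ε ≤ 1`.
[cite: Tao2016AveragedNS, §6.1 (6.1)–(6.4) (the table being compared); cell vocabulary] -/
theorem isComparableCoeffOn_mirrorTable {ε : ℝ} (hε : 0 < ε) (hε1 : ε ≤ 1) :
    IsComparableCoeffOn shiftSetFlat (2 / ε) (mirrorTable ε ε) := by
  have hinv : (2 / ε)⁻¹ = ε / 2 := by rw [inv_div]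
  refine ⟨fun i₁ i₂ i₃ μ _hμ => ?_, fun i₁ i₂ i₃ μ hμ => mirrorTable_eq_zero_of_not_mem ε ε i₁ i₂ i₃ μ hμ⟩
  rw [hinv]
  rcases mirrorTable_values ε ε i₁ i₂ i₃ μ with h | h | h | h | h | h | h | h | h <;> rw [h]
  · simp
  · simp; linarith
  · refine ⟨?_, Or.inr ?_⟩
    · rw [abs_of_pos (by norm_num : (0:ℝ) < 1 / 2)]; norm_num
    · rw [abs_of_pos (by norm_num : (0:ℝ) < 1 / 2)]; linarith
  · refine ⟨?_, Or.inr ?_⟩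
    · rw [abs_of_pos hε]; exact hε1
    · rw [abs_of_pos hε]; linarith
  · rw [show -ε / 2 = -(ε / 2) by ring]
    refine ⟨?_, Or.inr ?_⟩
    · rw [abs_neg, abs_of_pos (by positivity : (0:ℝ) < ε / 2)]; linarith
    · rw [abs_neg, abs_of_pos (by positivity : (0:ℝ) < ε / 2)]
  · simp; linarith
  · rw [show (-1 : ℝ) / 2 = -(1 / 2) by ring]
    refine ⟨?_, Or.inr ?_⟩
    · rw [abs_neg, abs_of_pos (by norm_num : (0:ℝ) < 1 / 2)]; norm_num
    · rw [abs_neg, abs_of_pos (by norm_num : (0:ℝ) < 1 / 2)]; linarith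
  · refine ⟨?_, Or.inr ?_⟩
    · rw [abs_neg, abs_of_pos hε]; exact hε1
    · rw [abs_neg, abs_of_pos hε]; linarith
  · refine ⟨?_, Or.inr ?_⟩
    · rw [abs_of_pos (by positivity : (0:ℝ) < ε / 2)]; linarith
    · rw [abs_of_pos (by positivity : (0:ℝ) < ε / 2)]

/-- **The mirror-seeded Toda table at `δ = ε ∈ (0, 1]` lies in the class `E(S♭, 2/ε)`** (symmetric,
cancelling, `(2/ε)`-comparable, supported on `S♭`); in particular `mirrorTable (1/2) (1/2) ∈ E(S♭, 4)`.
[cite: Tao2016AveragedNS, §4 (4.2)–(4.3) and §6.1; route TaoLadderRungTwoFlat, skeleton stub `stub_mirrorTable_mem`] -/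
theorem inTableClassOn_mirrorTable {ε : ℝ} (hε : 0 < ε) (hε1 : ε ≤ 1) :
    InTableClassOn shiftSetFlat (2 / ε) (mirrorTable ε ε) :=
  ⟨isSymmetricCoeffOn_mirrorTable ε ε, isCancellingCoeffOn_mirrorTable ε ε,
    isComparableCoeffOn_mirrorTable hε hε1⟩

/-- `mirrorTable (1/2) (1/2) ∈ E(S♭, 4)` (the table of the registered stubs `stub_rung` / `stub_rung_quarter`).
[cite: Tao2016AveragedNS, §4 (4.2)–(4.3) and §6.1; route TaoLadderRungTwoFlat] -/
theorem inTableClassOn_mirrorTable_half :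
    InTableClassOn shiftSetFlat 4 (mirrorTable (1 / 2) (1 / 2)) := by
  have h := inTableClassOn_mirrorTable (ε := 1 / 2) (by norm_num) (by norm_num)
  norm_num at h
  exact h

end Summit.NavierStokesRegularity.NavierStokesRegularity.Theorems

end
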